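import Literature.Geometry.Lorentzian.KerrFarLeafEnergy
import Literature.Analysis.Calculus.HardyEulerWeighted
import HarnessLib

/-!
# The smeared Hardy inequality along a hyperboloidal leaf `Σ̃_t(h♯_{R₁})` of subextremal Kerr

(family `gr`; the (HardyHyperboloid) step of Moschidis, arXiv:1509.08489, proof of Lemma 4.5, in
the smeared-truncation framework of `KerrSchildTruncatedCurrent.lean`; infrastructure for
statement **gr.S24**; namespace `Literature.Geometry.Lorentzian.Kerr`)

On the leaf `Σ̃_t = {(t + h♯(y), y)}` put `u(y) = ψ̃(t + h♯(y), y)` (the restriction of the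
extension by zero of an admissible wave) and the weight `w(y) = χ(T − t − h♯(y)) f(y)`
(`χ = Real.smoothTransition`, `f = u_{R',R'}` the radial cut-off vanishing on `‖y‖ ≤ R'`). Then
`w ∈ C¹`, `w ≥ 0`, `0 ∉ tsupport w`, `u` is `C¹` near `tsupport w ⊆ {‖y‖ ≥ R'}` (far region), and
at the points of `tsupport w` (where `t + h♯(y) ≤ T`) with `‖y‖ > ρ₀ + T` both `u` and `Du` vanish
(finite speed of propagation below the level `T`). Hence
`Literature.Analysis.Calculus.hardy_weighted_goodDeriv_le_of_eq_zero` applies: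

* `Kerr.leafHardy_smeared` (**proved**):
  `½ ∫ w u²/‖y‖² − ∫ (Dw(y)[y]) u²/‖y‖² ≤ 2 ∫ w (u + Du(y)[y])²/‖y‖²`,
  with `−Dw(y)[y] = χ'(T − t − h♯(y)) (Dh♯(y)[y]) f(y) − χ(T − t − h♯(y)) (Df(y)[y])`
  (`Kerr.fderiv_leafHardyWeight_apply_self`): the first part is the favourable smeared **edge term**
  of the leaf at the truncation (nonnegative where `h♯` increases radially), the second a collar term.

The right-hand side `(u + Du(y)[y])²/‖y‖² = (∂_ρ(ρu))²/ρ²` is the density of the `r^p`-boundary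
energy with `p = 0` along the leaf (to be compared with `Kerr.dafermosRodnianski_pHierarchy_scri`'s
`q` by the users). No definitions, no named facts (D-0026).

## References

* G. Moschidis, arXiv:1509.08489, proof of Lemma 4.5, (HardyHyperboloid) (key `Moschidis2016`).
* M. Dafermos, I. Rodnianski, Y. Shlapentokh-Rothman, arXiv:1402.7034, §4.3
  (key `DafermosRodnianskiShlapentokhrothman2014`).
-/

noncomputable section

open Bundle Set TopologicalSpace Filter MeasureTheory Metric
open scoped Manifold ContDiff Topology ENNReal

namespace Literature.Geometry.Lorentzian

namespace Kerr

variable [Facts] [SliceFacts]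

omit [Facts] [SliceFacts] in
/-- **The derivative of the leaf Hardy weight along `y`**: for `w(y) = χ(T − t − h(y)) f(y)` with
`h`, `f` differentiable at `y`,
`Dw(y)[y] = −χ'(T − t − h(y)) (Dh(y)[y]) f(y) + χ(T − t − h(y)) (Df(y)[y])`. [folklore] -/
theorem fderiv_leafHardyWeight_apply_self {h f : E3 → ℝ} {y : E3} (hh : DifferentiableAt ℝ h y)
    (hf : DifferentiableAt ℝ f y) (T t : ℝ) :
    fderiv ℝ (fun z ↦ Real.smoothTransition (T - (t + h z)) * f z) y y =
      -(deriv Real.smoothTransition (T - (t + h y)) * fderiv ℝ h y y * f y) +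
        Real.smoothTransition (T - (t + h y)) * fderiv ℝ f y y := by
  have hχ : HasDerivAt Real.smoothTransition (deriv Real.smoothTransition (T - (t + h y)))
      (T - (t + h y)) :=
    ((Real.smoothTransition.contDiff (n := 1)).differentiable one_ne_zero _).hasDerivAt
  have hin : HasFDerivAt (fun z ↦ T - (t + h z)) (-fderiv ℝ h y) y := by
    have := (hh.hasFDerivAt.const_add t).const_sub T
    simpa using this
  have h1 : HasFDerivAt (fun z ↦ Real.smoothTransition (T - (t + h z)))
      (deriv Real.smoothTransition (T - (t + h y)) • (-fderiv ℝ h y)) y := by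
    have := hχ.comp_hasFDerivAt y hin
    exact this
  have h2 : HasFDerivAt (fun z ↦ Real.smoothTransition (T - (t + h z)) * f z)
      (Real.smoothTransition (T - (t + h y)) • fderiv ℝ f y +
        f y • (deriv Real.smoothTransition (T - (t + h y)) • (-fderiv ℝ h y))) y :=
    h1.mul hf.hasFDerivAt
  rw [h2.fderiv]
  simp only [_root_.add_apply, _root_.smul_apply, smul_eq_mul, _root_.neg_apply]
  ring

/-- **The smeared Hardy inequality along the leaf `Σ̃_t(h♯_{R₁})`** (Moschidis, arXiv:1509.08489,
proof of Lemma 4.5, (HardyHyperboloid), smeared in time). For `|a| < M`, `R₁ > 2M`, `R' > R_af`,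
an admissible `ψ` with `ρ₀` as in `IsAdmissibleKerrWave.exists_extend_eq_zero_of_lt`, `t ≥ 0` and a
level `T`: with `u(y) = ψ̃(t + h♯(y), y)`, `w(y) = χ(T − t − h♯(y)) u_{R',R'}(y)`,
`½ ∫ w u²/‖y‖² − ∫ (Dw(y)[y]) u²/‖y‖² ≤ 2 ∫ w (u + Du(y)[y])²/‖y‖²`.
[cite: Moschidis2016, Lemma 4.5 (proof)] -/
theorem leafHardy_smeared {M a R₁ R' : ℝ} (hMa : IsSubextremal M a) (hR₁ : 2 * M < R₁)
    (hR'af : afRadius a (rPlus M a) < R') {ψ : region a (rPlus M a) → ℝ}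
    (hψ : IsAdmissibleKerrWave M a ψ) {ρ₀ : ℝ} (hρ₀0 : 0 ≤ ρ₀)
    (hρ₀ : ∀ x : E4, 0 ≤ x 0 → ρ₀ + x 0 < E4.spatialNorm x →
      Function.extend Subtype.val ψ 0 x = 0 ∧ fderiv ℝ (Function.extend Subtype.val ψ 0) x = 0)
    {t : ℝ} (ht : 0 ≤ t) {T : ℝ} (hT : 0 < T) :
    (1 / 2) * (∫ y : E3, Real.smoothTransition (T - (t + scriHeight M a R₁ y)) * radialTransition R' R' y *
        (Function.extend Subtype.val ψ 0 (leafPoint (scriHeight M a R₁) t y)) ^ 2 / ‖y‖ ^ 2) -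
      ∫ y : E3, fderiv ℝ (fun z ↦ Real.smoothTransition (T - (t + scriHeight M a R₁ z)) *
          radialTransition R' R' z) y y *
        (Function.extend Subtype.val ψ 0 (leafPoint (scriHeight M a R₁) t y)) ^ 2 / ‖y‖ ^ 2 ≤
      2 * ∫ y : E3, Real.smoothTransition (T - (t + scriHeight M a R₁ y)) * radialTransition R' R' y *
        (Function.extend Subtype.val ψ 0 (leafPoint (scriHeight M a R₁) t y) +
          fderiv ℝ (fun z ↦ Function.extend Subtype.val ψ 0 (leafPoint (scriHeight M a R₁) t z)) y y) ^ 2 /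
          ‖y‖ ^ 2 := by
  have hM : 0 < M := hMa.pos
  have hR' : 0 < R' := (afRadius_pos a (rPlus M a)).trans hR'af
  have hRp : rPlus M a < R₁ := (rPlus_le_two_mul hM.le).trans_lt hR₁
  set Φ : E4 → ℝ := Function.extend Subtype.val ψ 0 with hΦ
  set h : E3 → ℝ := scriHeight M a R₁ with hh
  set L : E3 → E4 := leafPoint h t with hL
  set u : E3 → ℝ := fun y ↦ Φ (L y) with hu
  set w : E3 → ℝ := fun y ↦ Real.smoothTransition (T - (t + h y)) * radialTransition R' R' y with hw
  have hF : ContDiff ℝ 2 h := hMa.contDiff_scriHeight hRp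
  have hh0 : ∀ y, 0 ≤ h y := fun y ↦ scriHeight_nonneg hMa hRp y
  -- the leaf map is `C²` with derivative `v ↦ (Dh(y)[v], v)`
  have hLeq : L = fun y ↦ (t + h y) • E4.basisVector 0 + E4.spaceEmbed y := by
    funext y; rw [hL, leafPoint]; exact E4.ofTimeSpace_eq_smul_add' _ _
  have hLC : ContDiff ℝ 2 L := by
    rw [hLeq]
    exact ((contDiff_const.add hF).smul contDiff_const).add E4.spaceEmbed.contDiff
  have hLd : ∀ y, HasFDerivAt L ((fderiv ℝ h y).smulRight (E4.basisVector 0) + E4.spaceEmbed) y :=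
    fun y ↦ E4.hasFDerivAt_graphMap ((hF.differentiable (by norm_num)) y).hasFDerivAt t
  have hLsp : ∀ y, E4.spatialNorm (L y) = ‖y‖ := fun y ↦ E4.spatialNorm_ofTimeSpace _ _
  have hL0 : ∀ y, L y 0 = t + h y := fun y ↦ E4.ofTimeSpace_apply_zero _ _
  -- the weight
  have hf1 : ContDiff ℝ 1 (radialTransition R' R') := contDiff_radialTransition hR' hR'
  have hwC : ContDiff ℝ 1 w :=
    ((Real.smoothTransition.contDiff (n := 1)).comp
      (contDiff_const.sub (contDiff_const.add (hF.of_le one_le_two)))).mul hf1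
  have hw0 : ∀ y, 0 ≤ w y := fun y ↦
    mul_nonneg (Real.smoothTransition.nonneg _) (radialTransition_nonneg _ _ _)
  have hwsupp : tsupport w ⊆ {y : E3 | R' ≤ ‖y‖} := by
    refine (tsupport_mul_subset_right (f := fun y ↦ Real.smoothTransition (T - (t + h y)))
      (g := radialTransition R' R')).trans ?_
    refine closure_minimal (fun y hy ↦ ?_) (isClosed_le continuous_const continuous_norm)
    by_contra hlt
    simp only [mem_setOf_eq, not_le] at hlt
    exact hy (radialTransition_of_norm_le hR' hlt.le)
  have h0 : (0 : E3) ∉ tsupport w := fun hmem ↦ by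
    have := hwsupp hmem
    simp only [mem_setOf_eq, norm_zero] at this
    exact absurd this (not_le.2 hR')
  -- `tsupport w ⊆ {t + h ≤ T}`
  have hwT : tsupport w ⊆ {y : E3 | t + h y ≤ T} := by
    refine closure_minimal (fun y hy ↦ ?_) ?_
    · by_contra hlt
      simp only [mem_setOf_eq, not_le] at hlt
      exact hy (by simp [hw, Real.smoothTransition.zero_of_nonpos (by linarith : T - (t + h y) ≤ 0)])
    · exact isClosed_le (continuous_const.add hF.continuous) continuous_const
  -- `u` is `C¹` near `tsupport w` (far region)
  have hfar : ∀ y ∈ tsupport w, L y ∈ region a (rPlus M a) := fun y hy ↦ by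
    refine mem_region_of_afRadius_lt_spatialNorm ?_
    rw [hLsp]; exact hR'af.trans_le (hwsupp hy)
  have huC : ∀ y ∈ tsupport w, ContDiffAt ℝ 1 u y := fun y hy ↦
    ((hψ.contDiffAt_extend_of_mem (hfar y hy)).of_le le_rfl).comp y (hLC.contDiffAt.of_le one_le_two)
  -- `u = Du = 0` on `tsupport w` beyond `ρ₀ + T`
  have hvan : ∀ y ∈ tsupport w, ρ₀ + T < ‖y‖ → Φ (L y) = 0 ∧ fderiv ℝ Φ (L y) = 0 := by
    intro y hy hyR
    have hy0 := hh0 y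
    have hyT : t + h y ≤ T := hwT hy
    have h0' : 0 ≤ L y 0 := by rw [hL0]; linarith
    have h1' : ρ₀ + L y 0 < E4.spatialNorm (L y) := by rw [hL0, hLsp]; linarith
    exact hρ₀ (L y) h0' h1'
  have huR : ∀ y ∈ tsupport w, ρ₀ + T < ‖y‖ → u y = 0 := fun y hy hyR ↦ (hvan y hy hyR).1
  have hDuR : ∀ y ∈ tsupport w, ρ₀ + T < ‖y‖ → fderiv ℝ u y = 0 := by
    intro y hy hyR
    have hd : HasFDerivAt u ((fderiv ℝ Φ (L y)).comp
        ((fderiv ℝ h y).smulRight (E4.basisVector 0) + E4.spaceEmbed)) y :=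
      ((hψ.contDiffAt_extend_of_mem (hfar y hy)).differentiableAt one_ne_zero).hasFDerivAt.comp y
        (hLd y)
    rw [hd.fderiv, (hvan y hy hyR).2, ContinuousLinearMap.zero_comp]
  have key := Literature.Analysis.Calculus.hardy_weighted_goodDeriv_le_of_eq_zero
    (E := E3) (by simp) hwC hw0 h0 huC (R := ρ₀ + T) (by linarith) huR hDuR
  simpa only [hw, hu, mul_assoc] using key

end Kerr

end Literature.Geometry.Lorentzian
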